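/-
Copyright (c) 2026 the pub-hodgecm-mathlib formalisation cell (harness21).  Prover seat hodgecm-mathlib-K2Liu-p09 (g0): Track B «K2-LIT»,
#184♮ = hLiu418 = stmt-HodgeConjecture-24832, file #9 of the K2_Liu road, organ (III-b) step E5′ (A1: the `GL_k` shell integral); 2026-09-03.
-/
import Literature.NumberTheory.Automorphic.SiegelShellDomination   -- ★ `scalarExp`, `shell`, `setLIntegral_center_mul_le_tsum_mul`, `glAbsDet`
import HarnessLib

/-!
# Crux `HLiu418`, Track B road `K2_Liu`, unit U3a «SIEGEL EISENSTEIN SERIES», file #9 — helper 12 (organ (III-b), step E5′, part A1):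
# Godement's shell integral on `A_G · 𝔖 ⊆ GL_k(𝔸_K)` and the `k!`-trick for characters of `GL_k`

Cell `hodgecm-mathlib`, crux item hLiu418 = `stmt-HodgeConjecture-24832`; squad K2 ∕ K2Liu, prover K2Liu-p09 (g0).  THEOREMS ONLY; lane
`--supports stmt-HodgeConjecture-24832` (count-neutral helper toward socket #9 `sig_K2LiuSiegelEisensteinDoubledSummable` via the single
remaining stub E5′ «parabolic integral on `P_Δ(𝔸)`» of the skeleton of record, PLAN v3 §A).

The `GL_k(𝔸_K)`-side of Godement's criterion for the Siegel parabolic.  For a Haar measure `ν` on `GL_k(𝔸_K)` (`k ≥ 1`), Siegel data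
`Ω ⊆ B(𝔸_K)` compact, `t > 0`, exponents `0 < e`, `0 ≤ τ`, `c₀ < k·[K:ℚ]·e·τ`, and ANY `ψ : GL_k(𝔸_K) → [0, ∞]` with
`ψ(z(eˢ) g) ≤ C_ψ · e^{−c₀ s}` on `𝔖 = Ω · A_{T₀}(t) · K` (`z(eˢ) = scalarExp`, the split centre `A_G`):

* **`setLIntegral_center_mul_siegel_rpow_mul_lt_top`** — `∫⁻_{A_G 𝔖} 𝟙{|det x|ᵉ ≤ C₁} · (|det x|ᵉ)^τ · ψ(x) dν(x) < ∞` for every `C₁`: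
  the `j`-th centre shell `z(e^{[j,j+1]}) 𝔖` carries `|det| ≍ e^{jk[K:ℚ]}` (★ `glAbsDet_posRealScalar`, `= 1` on the cone, bounded on `Ω`, `K`), so the
  integrand is `≤ M e^{j(k[K:ℚ]eτ − c₀)}` there and vanishes for `j ≫ log C₁`; the shells all have the measure of `z(e^{[0,1]}) 𝔖 < ∞`
  (★ `measure_mul_siegelSet_lt_top`), and ★ `setLIntegral_center_mul_le_tsum_mul` sums the two-sided geometric series
  [Godement, Sém. Bourbaki 257 §8; Garrett (2018) §3.10, proof of Cor. 3.10.2; Moeglin–Waldspurger II.1.5];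
* **`map_glDiagonal_eq_one_of_prod_eq_one`** (the `k!`-TRICK) — a homomorphism `φ : GL_k(R) → A` to a commutative monoid without
  torsion kills every diagonal `diag(d)` with `∏ dᵢ = 1`: `φ` is invariant under the Weyl group (★ `map_glDiagonal_comp_perm`), and
  `∏_{σ ∈ S_k} diag(d ∘ σ)` is a scalar `c·1` with `c^k = 1`, so `φ(diag d)^{k!·k} = 1`.  (Used with `φ = θ` = the module of the Levi
  action on `N_Δ(𝔸)`: `θ = 1` on the Siegel cone with NO computation.)

HONEST LABEL.  Count-neutral helper of the K2_Liu road; it retires nothing by itself: `HC_CM` is proved only modulo the 7 printed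
citations (2 remaining named inputs: hLiu418 = `stmt-HodgeConjecture-24832`, h413 = `stmt-HodgeConjecture-24833`) until rung 0 closes.

## References
* [Godement1964] R. Godement, *Domaines fondamentaux des groupes arithmétiques*, Sém. Bourbaki 257 (1962/63), §8.
* [Garrett2018] P. Garrett, *Modern Analysis of Automorphic Forms by Example* (2018), §3.10 (proof of Cor. 3.10.2).
* [MoeglinWaldspurger1995] C. Moeglin, J.-L. Waldspurger, *Spectral decomposition and Eisenstein series* (1995), II.1.5.
-/

set_option autoImplicit false
-- the mandated namespace repeats the single-problem summit's segment (`HodgeConjecture.HodgeConjecture`)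
set_option linter.dupNamespace false

noncomputable section

open scoped NNReal ENNReal Pointwise MatrixGroups
open MeasureTheory Measure NumberField IsDedekindDomain Set

namespace Summit.HodgeConjecture.HodgeConjecture.Cruxes.HLiu418.K2LiuGodementSiegelShellIntegral

open Literature.NumberTheory.Automorphic

/-! ## §1 The `k!`-trick: torsion-free characters of `GL_k(R)` kill the norm-one diagonal -/

section Torsion

variable {k : ℕ} {R : Type*} [CommRing R] {A : Type*} [CommMonoid A] (φ : GL (Fin k) R →* A)

/-- For `d : Fin k → Rˣ` the `i`-th entry of the pointwise product `∏_{σ ∈ S_k} (d ∘ σ)` does not depend on `i`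
(reindex `σ ↦ σ · (i j)`). [folklore] -/
theorem prod_perm_comp_apply_eq (d : Fin k → Rˣ) (i j : Fin k) :
    (∏ σ : Equiv.Perm (Fin k), (d ∘ σ)) i = (∏ σ : Equiv.Perm (Fin k), (d ∘ σ)) j := by
  rw [Finset.prod_apply, Finset.prod_apply]
  refine Fintype.prod_equiv (Equiv.mulRight (Equiv.swap i j)) (fun σ => (d ∘ σ) i) (fun σ => (d ∘ σ) j)
    fun σ => ?_
  simp only [Function.comp_apply, Equiv.coe_mulRight, Equiv.Perm.mul_apply, Equiv.swap_apply_right]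

/-- For `d : Fin k → Rˣ` with `∏ dᵢ = 1`, the product of ALL entries of `∏_{σ ∈ S_k} (d ∘ σ)` is `1`. [folklore] -/
theorem prod_prod_perm_comp_apply (d : Fin k → Rˣ) (hd : ∏ i, d i = 1) :
    ∏ i, (∏ σ : Equiv.Perm (Fin k), (d ∘ σ)) i = 1 := by
  simp_rw [Finset.prod_apply]
  rw [Finset.prod_comm]
  refine Finset.prod_eq_one fun σ _ => ?_
  rw [show (∏ i, (d ∘ σ) i) = ∏ i, d i from Equiv.prod_comp σ d, hd]

/-- **The `k!`-trick.**  A homomorphism `φ : GL_k(R) → A` to a commutative monoid `A` without torsion (`a^m = 1 ⇒ a = 1` for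
`m ≥ 1`) is trivial on every diagonal matrix `diag(d)` with `∏ dᵢ = 1`: `φ(diag(d ∘ σ)) = φ(diag d)` for every permutation `σ`
(★ `map_glDiagonal_comp_perm`), the pointwise product `D = ∏_σ (d ∘ σ)` is a constant `c` with `c^k = ∏ᵢ Dᵢ = 1`, whence
`φ(diag d)^{k!·k} = φ(diag D)^k = φ(diag(c^k)) = 1`. [folklore] -/
theorem map_glDiagonal_eq_one_of_prod_eq_one (htors : ∀ (a : A) (m : ℕ), 0 < m → a ^ m = 1 → a = 1)
    (d : Fin k → Rˣ) (hd : ∏ i, d i = 1) : φ (glDiagonal k R d) = 1 := by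
  rcases Nat.eq_zero_or_pos k with hk | hk
  · subst hk
    have : glDiagonal 0 R d = 1 := by
      refine Units.ext (Matrix.ext fun i _ => Fin.elim0 i)
    rw [this, map_one]
  · set D : Fin k → Rˣ := ∏ σ : Equiv.Perm (Fin k), (d ∘ σ) with hD
    obtain ⟨i₀⟩ : Nonempty (Fin k) := ⟨⟨0, hk⟩⟩
    set c : Rˣ := D i₀ with hc
    have hDc : D = fun _ => c := funext fun i => prod_perm_comp_apply_eq d i i₀
    have hck : c ^ k = 1 := by
      have h := prod_prod_perm_comp_apply d hd
      rw [← hD, hDc, Finset.prod_const, Finset.card_univ, Fintype.card_fin] at h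
      exact h
    -- `φ (diag D) = φ (diag d) ^ k!`
    have h1 : φ (glDiagonal k R D) = φ (glDiagonal k R d) ^ Fintype.card (Equiv.Perm (Fin k)) := by
      have h := map_prod (φ.comp (glDiagonal k R)) (fun σ : Equiv.Perm (Fin k) => d ∘ σ) Finset.univ
      simp only [MonoidHom.coe_comp, Function.comp_apply, map_glDiagonal_comp_perm, Finset.prod_const, Finset.card_univ] at h
      rw [hD]
      exact h
    -- `φ (diag D) ^ k = 1`
    have h2 : φ (glDiagonal k R D) ^ k = 1 := by
      rw [← map_pow, ← map_pow, hDc]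
      have : (fun _ : Fin k => c) ^ k = fun _ : Fin k => c ^ k := by funext i; simp
      rw [this, hck]
      have h1' : (fun _ : Fin k => (1 : Rˣ)) = 1 := rfl
      rw [h1', map_one, map_one]
    refine htors _ (Fintype.card (Equiv.Perm (Fin k)) * k) (Nat.mul_pos Fintype.card_pos hk) ?_
    rw [pow_mul, ← h1, h2]

end Torsion

/-! ## §2 `|det|` on the thickened Siegel set `A_G · Ω · A_{T₀}(t) · K` -/

section Det

variable (k : ℕ) (K : Type) [Field K] [NumberField K]

/-- `|det (z(eˢ) g)| = e^{s k [K:ℚ]} |det g|`. [folklore] -/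
theorem glAbsDet_scalarExp_mul_real (s : ℝ) (g : GL (Fin k) (AdeleRing (𝓞 K) K)) :
    ((glAbsDet k K (scalarExp k K s * g) : ℝ≥0) : ℝ) =
      Real.exp (s * (k * Module.finrank ℚ K : ℕ)) * ((glAbsDet k K g : ℝ≥0) : ℝ) := by
  rw [map_mul, Units.val_mul, NNReal.coe_mul, scalarExp, glAbsDet_posRealScalar, Units.val_pow_eq_pow_val, NNReal.coe_pow,
    coe_expUnitNNReal, ← Real.exp_nat_mul, mul_comm ((k * Module.finrank ℚ K : ℕ) : ℝ) s]

/-- **Two-sided bounds for `|det|` on `Ω · A_{T₀}(t) · K`** (`Ω` compact): `0 < lo ≤ |det (ω a κ)| ≤ hi` with `1 ≤ hi`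
(`|det a| = 1` on the cone, continuity of `|det|` on the compact sets `Ω`, `K`). [folklore] -/
theorem exists_glAbsDet_bounds_siegel {Ω : Set (GL (Fin k) (AdeleRing (𝓞 K) K))} (hΩc : IsCompact Ω) (t : ℝ) :
    ∃ lo hi : ℝ, 0 < lo ∧ 1 ≤ hi ∧ ∀ g ∈ Ω * siegelCone k K t * (standardMaximalCompactGL k K : Set (GL (Fin k) (AdeleRing (𝓞 K) K))),
      lo ≤ ((glAbsDet k K g : ℝ≥0) : ℝ) ∧ ((glAbsDet k K g : ℝ≥0) : ℝ) ≤ hi := by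
  set f : GL (Fin k) (AdeleRing (𝓞 K) K) → ℝ := fun g => ((glAbsDet k K g : ℝ≥0) : ℝ) with hf
  have hfc : Continuous f := continuous_glAbsDet_real k K
  have hfpos : ∀ g, 0 < f g := fun g => NNReal.coe_pos.2 (pos_iff_ne_zero.2 (glAbsDet k K g).ne_zero)
  have hfmul : ∀ g h, f (g * h) = f g * f h := fun g h => by
    change (((glAbsDet k K (g * h) : ℝ≥0ˣ) : ℝ≥0) : ℝ) = _
    rw [map_mul, Units.val_mul, NNReal.coe_mul]
  have hbd : ∀ C : Set (GL (Fin k) (AdeleRing (𝓞 K) K)), IsCompact C →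
      ∃ lo, 0 < lo ∧ ∃ hi, 1 ≤ hi ∧ ∀ c ∈ C, lo ≤ f c ∧ f c ≤ hi := by
    intro C hC
    rcases C.eq_empty_or_nonempty with h | hne
    · exact ⟨1, one_pos, 1, le_rfl, fun c hc => by rw [h] at hc; exact absurd hc (Set.notMem_empty c)⟩
    · obtain ⟨c₀, -, hmin⟩ := hC.exists_isMinOn hne hfc.continuousOn
      obtain ⟨c₁, -, hmax⟩ := hC.exists_isMaxOn hne hfc.continuousOn
      exact ⟨f c₀, hfpos c₀, max (f c₁) 1, le_max_right _ _, fun c hc => ⟨hmin hc, (hmax hc).trans (le_max_left _ _)⟩⟩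
  obtain ⟨lo₁, hlo₁, hi₁, hhi₁, hΩbd⟩ := hbd Ω hΩc
  obtain ⟨lo₂, hlo₂, hi₂, hhi₂, hKbd⟩ := hbd _ (isCompact_standardMaximalCompactGL k K)
  refine ⟨lo₁ * lo₂, hi₁ * hi₂, mul_pos hlo₁ hlo₂, one_le_mul_of_one_le_of_one_le hhi₁ hhi₂, ?_⟩
  rintro g ⟨_, ⟨ω, hω, a, ha, rfl⟩, κ, hκ, rfl⟩
  have hfa : f a = 1 := by
    change (((glAbsDet k K a : ℝ≥0ˣ) : ℝ≥0) : ℝ) = 1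
    rw [glAbsDet_eq_one_of_mem_siegelCone ha, Units.val_one, NNReal.coe_one]
  change lo₁ * lo₂ ≤ f (ω * a * κ) ∧ f (ω * a * κ) ≤ hi₁ * hi₂
  rw [hfmul, hfmul, hfa, mul_one]
  exact ⟨mul_le_mul (hΩbd ω hω).1 (hKbd κ hκ).1 hlo₂.le (hfpos ω).le,
    mul_le_mul (hΩbd ω hω).2 (hKbd κ hκ).2 (hfpos κ).le (zero_le_one.trans hhi₁)⟩

end Det

/-! ## §3 A two-sided geometric series over `ℤ` -/

section Series

/-- `Σ_{j ∈ ℤ} e^{−β |j − s₁|} < ∞` for `β > 0`, as an `ℝ≥0∞`-valued sum of `ENNReal.ofReal`s with a constant factor. [folklore] -/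
theorem tsum_ofReal_exp_neg_mul_abs_sub_ne_top {β : ℝ} (hβ : 0 < β) (M s₁ : ℝ) :
    (∑' j : ℤ, ENNReal.ofReal (M * Real.exp (-(β * |(j : ℝ) - s₁|)))) ≠ ∞ := by
  -- compare with `e^{β |s₁|} e^{-β |j|}`
  have hle : ∀ j : ℤ, M * Real.exp (-(β * |(j : ℝ) - s₁|)) ≤ max M 0 * (Real.exp (β * |s₁|) * Real.exp (-(β * |(j : ℝ)|))) := by
    intro j
    have h1 : Real.exp (-(β * |(j : ℝ) - s₁|)) ≤ Real.exp (β * |s₁|) * Real.exp (-(β * |(j : ℝ)|)) := by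
      rw [← Real.exp_add]
      refine Real.exp_le_exp.2 ?_
      have := abs_sub_abs_le_abs_sub (j : ℝ) s₁
      nlinarith [abs_nonneg s₁, abs_nonneg ((j : ℝ) - s₁)]
    calc M * Real.exp (-(β * |(j : ℝ) - s₁|)) ≤ max M 0 * Real.exp (-(β * |(j : ℝ) - s₁|)) :=
          mul_le_mul_of_nonneg_right (le_max_left _ _) (Real.exp_pos _).le
      _ ≤ max M 0 * (Real.exp (β * |s₁|) * Real.exp (-(β * |(j : ℝ)|))) :=
          mul_le_mul_of_nonneg_left h1 (le_max_right _ _)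
  -- the comparison series is summable over `ℤ`
  have hnat : Summable fun m : ℕ => Real.exp (-(β * |((m : ℤ) : ℝ)|)) := by
    have h := Real.summable_exp_nat_mul_iff.2 (neg_lt_zero.2 hβ)
    refine h.congr fun m => ?_
    rw [Int.cast_natCast, abs_of_nonneg (Nat.cast_nonneg m)]
    ring_nf
  have hneg : Summable fun m : ℕ => Real.exp (-(β * |((-(m + 1 : ℤ) : ℤ) : ℝ)|)) := by
    have h := Real.summable_exp_nat_mul_iff.2 (neg_lt_zero.2 hβ)
    have h' : Summable fun m : ℕ => Real.exp (-β) * Real.exp ((m : ℝ) * -β) := h.mul_left _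
    refine h'.congr fun m => ?_
    rw [← Real.exp_add]
    congr 1
    push_cast
    rw [abs_of_nonpos (by linarith [(Nat.cast_nonneg m : (0 : ℝ) ≤ m)])]
    ring
  have hZ : Summable fun j : ℤ => Real.exp (-(β * |(j : ℝ)|)) := Summable.of_nat_of_neg_add_one hnat hneg
  have hZ' : Summable fun j : ℤ => max M 0 * (Real.exp (β * |s₁|) * Real.exp (-(β * |(j : ℝ)|))) :=
    (hZ.mul_left _).mul_left _
  refine ne_top_of_le_ne_top (ENNReal.ofReal_tsum_of_nonneg (fun j => ?_) hZ' ▸ ENNReal.ofReal_ne_top)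
    (ENNReal.tsum_le_tsum fun j => ENNReal.ofReal_le_ofReal (hle j))
  exact mul_nonneg (le_max_right _ _) (by positivity)

end Series

/-! ## §4 Godement's shell integral on `A_G · 𝔖` -/

section Shell

variable (k : ℕ) (K : Type) [Field K] [NumberField K]
variable [MeasurableSpace (GL (Fin k) (AdeleRing (𝓞 K) K))] [BorelSpace (GL (Fin k) (AdeleRing (𝓞 K) K))]

/-- **Godement's shell integral** (the `GL_k`-side of Godement's criterion for a maximal parabolic with Levi `GL_k`).  Let `ν` be a
Haar measure on `GL_k(𝔸_K)` (`k ≥ 1`, any Borel structure), `Ω ⊆ B(𝔸_K)` compact, `t > 0`, `0 < e`, `0 ≤ τ`, `c₀ < k [K:ℚ] e τ`, and `ψ ≥ 0` with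
`ψ(z(eˢ) g) ≤ C_ψ e^{−c₀ s}` for `g ∈ 𝔖 = Ω A_{T₀}(t) K` and all real `s`.  Then for every `C₁`,
`∫⁻_{A_G 𝔖} 𝟙{|det x|ᵉ ≤ C₁} (|det x|ᵉ)^τ ψ(x) dν(x) < ∞`.  Proof: on the shell `z(e^{[j,j+1]}) 𝔖` one has
`e^{jk[K:ℚ]} lo ≤ |det x| ≤ e^{(j+1)k[K:ℚ]} hi` (`exists_glAbsDet_bounds_siegel`, `glAbsDet_scalarExp_mul_real`), so the integrand is
`≤ ε_j = M e^{j(k[K:ℚ]eτ − c₀)}` and `ε_j = 0` once `(e^{jk[K:ℚ]} lo)ᵉ > C₁`; `Σ_j ε_j < ∞` (`tsum_ofReal_exp_neg_mul_abs_sub_ne_top`) and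
★ `setLIntegral_center_mul_le_tsum_mul` with `P = 1`, the `0`-th shell having finite measure (★ `measure_mul_siegelSet_lt_top`).
[cite: Godement1964, §8] [cite: Garrett2018, §3.10 (proof of Cor. 3.10.2)] -/
theorem setLIntegral_center_mul_siegel_rpow_mul_lt_top (hk : 0 < k) (ν : Measure (GL (Fin k) (AdeleRing (𝓞 K) K))) [ν.IsHaarMeasure]
    {Ω : Set (GL (Fin k) (AdeleRing (𝓞 K) K))} (hΩc : IsCompact Ω)
    (hΩB : Ω ⊆ (standardParabolicGL (AdeleRing (𝓞 K) K) (id : Fin k → Fin k) : Set (GL (Fin k) (AdeleRing (𝓞 K) K))))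
    {t : ℝ} (ht : 0 < t) {e τ c₀ Cψ : ℝ} (he : 0 < e) (hτ : 0 ≤ τ) (hc₀ : c₀ < (k * Module.finrank ℚ K : ℕ) * e * τ)
    {ψ : GL (Fin k) (AdeleRing (𝓞 K) K) → ℝ≥0∞}
    (hψ : ∀ (s : ℝ) (g : GL (Fin k) (AdeleRing (𝓞 K) K)),
      g ∈ Ω * siegelCone k K t * (standardMaximalCompactGL k K : Set (GL (Fin k) (AdeleRing (𝓞 K) K))) →
        ψ (scalarExp k K s * g) ≤ ENNReal.ofReal (Cψ * Real.exp (-(c₀ * s))))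
    (C₁ : ℝ) :
    ∫⁻ x in Set.range (scalarExp k K) * (Ω * siegelCone k K t * (standardMaximalCompactGL k K : Set (GL (Fin k) (AdeleRing (𝓞 K) K)))),
      {x | ((glAbsDet k K x : ℝ≥0) : ℝ) ^ e ≤ C₁}.indicator (fun x => ENNReal.ofReal ((((glAbsDet k K x : ℝ≥0) : ℝ) ^ e) ^ τ)) x * ψ x ∂ν < ∞ := by
  haveI : T2Space (GL (Fin k) (AdeleRing (𝓞 K) K)) := t2Space_gl k K
  -- the Borel structure is ★ `glAdeleBorel` (both are `borel _`)
  have hinst : ‹MeasurableSpace (GL (Fin k) (AdeleRing (𝓞 K) K))› = glAdeleBorel k K := BorelSpace.measurable_eq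
  subst hinst
  letI : MeasurableSpace (GL (Fin k) (AdeleRing (𝓞 K) K)) := glAdeleBorel k K
  set S₀ : Set (GL (Fin k) (AdeleRing (𝓞 K) K)) :=
    Ω * siegelCone k K t * (standardMaximalCompactGL k K : Set (GL (Fin k) (AdeleRing (𝓞 K) K))) with hS₀
  set N : GL (Fin k) (AdeleRing (𝓞 K) K) → ℝ := fun x => ((glAbsDet k K x : ℝ≥0) : ℝ) with hN
  have hNnn : ∀ x, 0 ≤ N x := fun x => NNReal.coe_nonneg _
  obtain ⟨lo, hi, hlo, hhi, hbd⟩ := exists_glAbsDet_bounds_siegel k K hΩc t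
  -- the dimension constant `D = k [K:ℚ] > 0` and the decay rate `β = D e τ - c₀ > 0`
  set D : ℕ := k * Module.finrank ℚ K with hD
  have hDpos : 0 < (D : ℝ) := by
    have : 0 < D := Nat.mul_pos hk Module.finrank_pos
    exact_mod_cast this
  set β : ℝ := (D : ℝ) * e * τ - c₀ with hβ
  have hβpos : 0 < β := by rw [hβ]; linarith
  -- the threshold `s₁`: `ε_j ≠ 0` forces `j ≤ s₁`
  set s₁ : ℝ := (Real.log (max C₁ 1) - e * Real.log lo) / ((D : ℝ) * e) with hs₁
  -- the constant
  set M : ℝ := (hi * Real.exp (D : ℝ)) ^ (e * τ) * (max Cψ 0 * Real.exp |c₀|) * Real.exp (β * s₁) with hM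
  set ε : ℤ → ℝ≥0∞ := fun j => ENNReal.ofReal (M * Real.exp (-(β * |(j : ℝ) - s₁|))) with hε
  -- the pointwise bound on the `j`-th shell
  have hQ : ∀ (j : ℤ) (s : ℝ), s ∈ Icc (j : ℝ) (j + 1) → ∀ g ∈ S₀,
      {x | N x ^ e ≤ C₁}.indicator (fun x => ENNReal.ofReal ((N x ^ e) ^ τ)) (scalarExp k K s * g) * ψ (scalarExp k K s * g) ≤ ε j := by
    intro j s hs g hg
    by_cases hx : scalarExp k K s * g ∈ {x | N x ^ e ≤ C₁}
    · rw [Set.indicator_of_mem hx]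
      have hNx : N (scalarExp k K s * g) = Real.exp (s * D) * N g := glAbsDet_scalarExp_mul_real k K s g
      have hx' : N (scalarExp k K s * g) ^ e ≤ C₁ := hx
      obtain ⟨hglo, hghi⟩ := hbd g hg
      -- `j ≤ s₁`
      have hC₁ : 0 < C₁ := lt_of_lt_of_le (Real.rpow_pos_of_pos (by rw [hNx]; exact mul_pos (Real.exp_pos _) (hlo.trans_le hglo)) e) hx'
      have hjs₁ : (j : ℝ) ≤ s₁ := by
        -- `(e^{jD} lo)^e ≤ N(x)^e ≤ C₁ ≤ max C₁ 1`
        have h1 : (Real.exp ((j : ℝ) * D) * lo) ^ e ≤ max C₁ 1 := by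
          refine le_trans (Real.rpow_le_rpow (by positivity) ?_ he.le) (hx'.trans (le_max_left _ _))
          rw [hNx]
          exact mul_le_mul (Real.exp_le_exp.2 (mul_le_mul_of_nonneg_right hs.1 hDpos.le)) hglo hlo.le (Real.exp_pos _).le
        have h2 : e * ((j : ℝ) * D + Real.log lo) ≤ Real.log (max C₁ 1) := by
          have h3 := Real.log_le_log (Real.rpow_pos_of_pos (by positivity) e) h1
          rwa [Real.log_rpow (by positivity), Real.log_mul (Real.exp_pos _).ne' hlo.ne', Real.log_exp] at h3
        rw [hs₁, le_div_iff₀ (mul_pos hDpos he)]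
        nlinarith
      -- the size bound
      have hNe : (N (scalarExp k K s * g) ^ e) ^ τ ≤ (hi * Real.exp (D : ℝ)) ^ (e * τ) * Real.exp ((D : ℝ) * e * τ * j) := by
        have h1 : N (scalarExp k K s * g) ≤ hi * Real.exp (D : ℝ) * Real.exp ((D : ℝ) * j) := by
          rw [hNx]
          calc Real.exp (s * D) * N g ≤ Real.exp (((j : ℝ) + 1) * D) * hi :=
                mul_le_mul (Real.exp_le_exp.2 (mul_le_mul_of_nonneg_right hs.2 hDpos.le)) hghi (hNnn g) (Real.exp_pos _).le
            _ = hi * Real.exp (D : ℝ) * Real.exp ((D : ℝ) * j) := by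
                rw [show ((j : ℝ) + 1) * D = (D : ℝ) + (D : ℝ) * j by ring, Real.exp_add]; ring
        calc (N (scalarExp k K s * g) ^ e) ^ τ = N (scalarExp k K s * g) ^ (e * τ) := by rw [← Real.rpow_mul (hNnn _)]
          _ ≤ (hi * Real.exp (D : ℝ) * Real.exp ((D : ℝ) * j)) ^ (e * τ) :=
              Real.rpow_le_rpow (hNnn _) h1 (mul_nonneg he.le hτ)
          _ = (hi * Real.exp (D : ℝ)) ^ (e * τ) * Real.exp ((D : ℝ) * e * τ * j) := by
              rw [Real.mul_rpow (by positivity) (Real.exp_pos _).le, ← Real.exp_mul]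
              ring_nf
      have hψ' : ψ (scalarExp k K s * g) ≤ ENNReal.ofReal (max Cψ 0 * Real.exp |c₀| * Real.exp (-(c₀ * j))) := by
        refine (hψ s g hg).trans (ENNReal.ofReal_le_ofReal ?_)
        calc Cψ * Real.exp (-(c₀ * s)) ≤ max Cψ 0 * Real.exp (-(c₀ * s)) :=
              mul_le_mul_of_nonneg_right (le_max_left _ _) (Real.exp_pos _).le
          _ ≤ max Cψ 0 * (Real.exp |c₀| * Real.exp (-(c₀ * j))) := by
              refine mul_le_mul_of_nonneg_left ?_ (le_max_right _ _)
              rw [← Real.exp_add]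
              refine Real.exp_le_exp.2 ?_
              have h1 : -(c₀ * s) = -(c₀ * j) + -(c₀ * (s - j)) := by ring
              have h2 : -(c₀ * (s - (j : ℝ))) ≤ |c₀| := by
                have hsj : 0 ≤ s - j := by linarith [hs.1]
                have hsj1 : s - j ≤ 1 := by linarith [hs.2]
                calc -(c₀ * (s - (j : ℝ))) ≤ |c₀ * (s - j)| := neg_le_abs _
                  _ = |c₀| * (s - j) := by rw [abs_mul, abs_of_nonneg hsj]
                  _ ≤ |c₀| * 1 := mul_le_mul_of_nonneg_left hsj1 (abs_nonneg _)
                  _ = |c₀| := mul_one _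
              linarith
          _ = max Cψ 0 * Real.exp |c₀| * Real.exp (-(c₀ * j)) := by ring
      -- combine: `≤ M e^{-β |j - s₁|}` using `j ≤ s₁`
      calc ENNReal.ofReal ((N (scalarExp k K s * g) ^ e) ^ τ) * ψ (scalarExp k K s * g)
          ≤ ENNReal.ofReal ((hi * Real.exp (D : ℝ)) ^ (e * τ) * Real.exp ((D : ℝ) * e * τ * j)) *
              ENNReal.ofReal (max Cψ 0 * Real.exp |c₀| * Real.exp (-(c₀ * j))) :=
            mul_le_mul' (ENNReal.ofReal_le_ofReal hNe) hψ'
        _ = ε j := by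
            rw [hε, ← ENNReal.ofReal_mul (by positivity)]
            congr 1
            have hjs : -(β * |(j : ℝ) - s₁|) = β * ((j : ℝ) - s₁) := by
              rw [abs_of_nonpos (by linarith), mul_neg, neg_neg]
            rw [hjs, hM]
            have : Real.exp ((D : ℝ) * e * τ * j) * Real.exp (-(c₀ * j)) = Real.exp (β * s₁) * Real.exp (β * ((j : ℝ) - s₁)) := by
              rw [← Real.exp_add, ← Real.exp_add, hβ]; ring_nf
            calc (hi * Real.exp (D : ℝ)) ^ (e * τ) * Real.exp ((D : ℝ) * e * τ * j) * (max Cψ 0 * Real.exp |c₀| * Real.exp (-(c₀ * j)))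
                = (hi * Real.exp (D : ℝ)) ^ (e * τ) * (max Cψ 0 * Real.exp |c₀|) *
                    (Real.exp ((D : ℝ) * e * τ * j) * Real.exp (-(c₀ * j))) := by ring
              _ = (hi * Real.exp (D : ℝ)) ^ (e * τ) * (max Cψ 0 * Real.exp |c₀|) * Real.exp (β * s₁) * Real.exp (β * ((j : ℝ) - s₁)) := by
                  rw [this]; ring
    · rw [Set.indicator_of_notMem hx, zero_mul]
      exact bot_le
  -- the shells are measurable, the `0`-th has finite measure
  have hS : ∀ j : ℤ, MeasurableSet (shell k K S₀ j) := fun j => measurableSet_shell_siegel hΩc ht j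
  have hshell0 : ν (shell k K S₀ 0) < ∞ := by
    rw [shell_eq_image_mul, hS₀]
    refine measure_mul_siegelSet_lt_top ν hΩc hΩB ht (isCompact_Icc.image (continuous_scalarExp (n := k) (K := K))) ?_
    rintro _ ⟨s, -, rfl⟩
    exact ⟨_, rfl⟩
  -- assemble
  have hmain := setLIntegral_center_mul_le_tsum_mul ν hS (P := fun _ => 1) measurable_const (fun _ _ => rfl) (ε := ε)
    (Q := fun x => {x | N x ^ e ≤ C₁}.indicator (fun x => ENNReal.ofReal ((N x ^ e) ^ τ)) x * ψ x) hQ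
  simp only [one_mul] at hmain
  refine lt_of_le_of_lt hmain (ENNReal.mul_lt_top (lt_top_iff_ne_top.2 (tsum_ofReal_exp_neg_mul_abs_sub_ne_top hβpos M s₁)) ?_)
  rw [setLIntegral_one]
  exact hshell0

end Shell

end Summit.HodgeConjecture.HodgeConjecture.Cruxes.HLiu418.K2LiuGodementSiegelShellIntegral

end
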